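import Summits.CriticalPhenomena.PercolationContinuityZ3.Theses.PercNearOneGluing
import HarnessLib.Audit

/-!
# Line `relay_count_gluing` — crux `PercNearOneGluing.NearOneGluing` (stmt-CriticalPhenomena-4574)

Strategist line (planner-cstrat-stmt-CriticalPhenomena-4574-h1-0, 2026-08-17), registered ALONGSIDE the
live line `Lines/SketchR2I5.lean` (lead c5: MAXATT / GL3 / RESCUE) and the alternative
`Lines/kn_shortening_induction.lean` (s1: KN Conjecture 6).  It shares no stub with either.

KERNEL ("RelayCountGluing", `stub_relayCountGluing`): for every finite weighted graph, every relay
set `A` and every source `o`,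
    `E |C(o) ∩ A|  ≥  P(o ↔ A) · min_{a ∈ A} E |C(a) ∩ A|`,
i.e. `Σ_{α∈A} P(o ↔ α) ≥ P(o ↔ A) · min_{a∈A} Σ_{α∈A} P(a ↔ α)`: given that `o` touches the relay
set, its footprint is on average at least the smallest mean relay-footprint ("size-biased capture").
This is Kozma–Nitzan's CONJECTURE 4 (arXiv:2401.12397 §5.1, p.32) in POST-FKG form at the single
monotone cluster property `f = |C ∩ A|`; it is implied by KN Conjecture 1 (ghost target joined to
`A` with weights `η/|A|`, `η → 0`), proved for `|A| = 2` (KN Thm 7 / two-line Harris) and when `o`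
is isolated in `G ∖ A` (KN Thm 8); it has NO target vertex and NO selection rule.  It implies the
crux with LINEAR rate `δ = ε/4` through the two glue stubs (`stub_meanCapture`: apply the kernel to
the `2δ`-cloud `A ∪ {b}`; `stub_gluingOfMeanCapture`: pigeonhole + union bound).

Calibration (line card, provable now, not a stub): the HARMONIC version
`P(o ↔ A) ≤ Σ_a P(o ↔ a) · E[1/|C_{G−o}(a) ∩ A|]` is a theorem (union bound over the clusters of
`G − o` hit by `o` + Harris for `hitting probability ↑ × 1/footprint ↓`); the kernel is exactly its
arithmetic-mean upgrade.  Evidence: 0 violations in > 10⁴ exact instances (n ≤ 7, all relay sets,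
four weight regimes) + adversarial coordinate climbs; equality only on the pendant locus
(`o` attached through a single relay that is the minimiser).  See `Lines/relay_count_gluing.md`.
-/

namespace Summit.CriticalPhenomena.PercolationContinuityZ3.Cruxes.NearOneGluing.RelayCountGluing

open MeasureTheory
open Literature.Probability.LatticeModels Literature.Probability.Percolation
open Summit.CriticalPhenomena.PercolationContinuityZ3.Theses.PercNearOneGluing (NearOneGluing)

/-- STUB 1 (KERNEL; CONJECTURAL — Kozma–Nitzan Conjecture 4, post-FKG, at `f = |C ∩ A|`;
sources: KozmaNitzan2024 §5.1 Conj 4 + Thms 7–8 (arXiv:2401.12397 p.32); implied by KN Conjecture 1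
via a ghost target (KN Thm 10's device); size: open).  **RelayCountGluing**, min-free form: if every
relay's mean footprint `Σ_{α∈A} P(a ↔ α)` is at least `t`, then `P(o ↔ A) · t ≤ Σ_{a∈A} P(o ↔ a)`.
(No side conditions are needed: `o ∈ A` makes it the hypothesis at `a = o`; `A = ∅` and `t ≤ 0`
are trivial.)  Leans on (for an attack): `prodBernoulli_harris`, the `G − o` cluster decomposition
`P(o ↔ a) = E[h(K_a)]` (`h` = probability that some `o`-edge into the cluster is open), the
calibration theorem `harmonicGluing` of the line card. -/
theorem stub_relayCountGluing :
    ∀ (n : ℕ) (w : Sym2 (Fin n) → unitInterval) (A : Finset (Fin n)) (o : Fin n) (t : ℝ),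
      (∀ a ∈ A, t ≤ ∑ α ∈ A, (prodBernoulli w).real (openConn a α)) →
      (prodBernoulli w).real (⋃ a ∈ A, openConn o a) * t ≤
        ∑ a ∈ A, (prodBernoulli w).real (openConn o a) := by
  sorry

/-- STUB 2 (GLUE, size M; sources: Harris union bound `P(a ↮ α) ≤ P(a ↮ b) + P(b ↮ α)`,
`measureReal_mono` for `⋃ a ∈ A ⊆ ⋃ a ∈ insert b A`, `Finset.sum_le_sum`, `Finset.card_insert_…`,
`probReal_compl_eq_one_sub`/`measureReal_compl`; cf. the bookkeeping of
`Theorems/PercNearOneGluingNearOneGluingMaxattGlue.lean`).  **Kernel ⇒ MeanCapture**: under the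
crux hypotheses at level `δ = ε/3`, the mean footprint of `o` on `A' := insert b A` is at least
`(1 - ε)|A'|`.  Proof: every `a ∈ A'` has `Σ_{α∈A'} P(a ↔ α) ≥ (1 - 2δ)|A'|` (each term `≥ 1 - 2δ`
through `b`; `P(a ↔ a) = 1`); apply STUB 1 with `t := (1 - 2δ)|A'|`; then
`Σ_{a∈A'} P(o↔a) ≥ P(o ↔ A')(1-2δ)|A'| ≥ P(o ↔ A)(1-2δ)|A'| > (1-δ)(1-2δ)|A'| ≥ (1-ε)|A'|`. -/
theorem stub_meanCapture :
    (∀ (n : ℕ) (w : Sym2 (Fin n) → unitInterval) (A : Finset (Fin n)) (o : Fin n) (t : ℝ),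
      (∀ a ∈ A, t ≤ ∑ α ∈ A, (prodBernoulli w).real (openConn a α)) →
      (prodBernoulli w).real (⋃ a ∈ A, openConn o a) * t ≤
        ∑ a ∈ A, (prodBernoulli w).real (openConn o a)) →
    ∀ ε : ℝ, 0 < ε → ∃ δ : ℝ, 0 < δ ∧ ∀ (n : ℕ) (w : Sym2 (Fin n) → unitInterval)
      (A : Finset (Fin n)) (o b : Fin n),
      1 - δ < (prodBernoulli w).real (⋃ a ∈ A, openConn o a) →
      (∀ a ∈ A, 1 - δ < (prodBernoulli w).real (openConn a b)) →
      (1 - ε) * ((insert b A).card : ℝ) ≤ ∑ a ∈ insert b A, (prodBernoulli w).real (openConn o a) := by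
  sorry

/-- STUB 3 (GLUE, size S–M; sources: pigeonhole `Finset.exists_le_of_sum_le` /
`Finset.sum_lt_sum_of_nonempty`, union bound `P(o ↮ b) ≤ P(o ↮ α) + P(α ↮ b)`,
`probReal_compl_eq_one_sub`).  **MeanCapture ⇒ the crux**: given `ε`, take `δ₀` from MeanCapture at
`ε/2` and `δ := min δ₀ (ε/4)`; MeanCapture gives some `α ∈ insert b A` with `P(o ↔ α) ≥ 1 - ε/2`
(else the sum is `< (1-ε/2)|A'|`), and `P(o ↮ b) ≤ P(o ↮ α) + P(α ↮ b) ≤ ε/2 + ε/4 < ε`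
(`α = b`: directly). -/
theorem stub_gluingOfMeanCapture :
    (∀ ε : ℝ, 0 < ε → ∃ δ : ℝ, 0 < δ ∧ ∀ (n : ℕ) (w : Sym2 (Fin n) → unitInterval)
      (A : Finset (Fin n)) (o b : Fin n),
      1 - δ < (prodBernoulli w).real (⋃ a ∈ A, openConn o a) →
      (∀ a ∈ A, 1 - δ < (prodBernoulli w).real (openConn a b)) →
      (1 - ε) * ((insert b A).card : ℝ) ≤ ∑ a ∈ insert b A, (prodBernoulli w).real (openConn o a)) →
    NearOneGluing := by
  sorry

/-- The composition: STUBS 1–3 give the crux BY NAME (real proof: the glue stubs applied to the kernel stub). -/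
theorem NearOneGluing_of : NearOneGluing :=
  stub_gluingOfMeanCapture (stub_meanCapture stub_relayCountGluing)

end Summit.CriticalPhenomena.PercolationContinuityZ3.Cruxes.NearOneGluing.RelayCountGluing
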